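import Summits.QuantumFields.BalabanUV.T4Continuum.Spine.NE4.AutonomousSchemeLinearized
import Mathlib.Analysis.Complex.Schwarz

/-!
# Spine/NE4/AutonomousSchemeAnalytic — (R46) THE ANALYTIC RUNG FOR THE DEFECT (N): the Lipschitz linearization defect of (R43) DERIVED from complex
# analyticity of the step in the STATE on a ball of ONE norm plus a sup bound (Schwarz's lemma), with second-order smallness

Cell `pub-balaban-gaps` (YM blitz G2), seat `ne4`, generation 11 (unit `pub-balaban-gaps-ne4-g11`); record `HOME/ne/NE4.md` §5 (R46).
HONEST FRAMING as in the other `AutonomousScheme*` files: hypothesis shapes about an ABSTRACT one-step map on a complex normed space + Mathlib complex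
analysis (the Banach-space Schwarz lemma) + elementary bookkeeping; NE4 (`T4CouplingMatching.ScaleShiftRate`, NOT IN PRINT — [Balaban1987RG1] = CMP **109**
p. 264) is NOT proved; nothing of Bałaban's is asserted; no status word of the cell moves (NE4 stays DEPENDENT, spine 0∕9).  One finite T⁴; NOT ℝ⁴, NOT infinite
volume, NOT a mass gap, NOT Clay.

THE POINT.  After (R43) ∕ (R45) the autonomous road's input list had exactly ONE item of MODULUS type, never printed in any form for Bałaban's RT: (N), a
Lipschitz bound `‖(A g x − A g y) − T₀(x − y)‖ ≤ δ‖x − y‖` for the step relative to its linearisation, small on a small ball (the cell's wall (M) — «print has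
sizes of the new terms, never a modulus in the old activities», [Balaban1988Convergent] = CMP **119** (2.43) p. 263 — in its weakest, local form).  On the β-SIDE
the cell traded exactly such moduli for ANALYTICITY + A SUP BOUND three times (census (R34) complex NE4 + Cauchy; (R37) real NE4 + two constants; (R40)
relative charts): regularity of printed TYPE converts sizes into moduli.  This file makes the same trade on the STATE side:

* §1 SHAPES.  `StateAnalytic A ϱ₀ M₀ γ`: at every coupling the step `A g` is complex-differentiable on the open ball `ball 0 ϱ₀` of ONE norm on the
  (complexified) state space, with `‖A g z − A g 0‖ ≤ M₀` there — analyticity with a uniform bound, the currency of Bałaban's own inductive hypotheses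
  for the FIELD dependence ([Balaban1987RG1] p. 264 «analytic … uniformly bounded») and of the printed |φ|⁴ template for the STATE dependence
  ([BrydgesSlade2015RGV] Thm 1.8.2: `K_+` «is analytic in (V, K)»; earlier, for polymer expansions of scalar fields «including infra-red φ⁴₄»,
  [BrydgesDimockHurd1998CJM] = Can. J. Math. **50** (1998) Thm 5 ∕ Thm 6, pp. 779–780: the extraction map «E is jointly analytic in K, F» with
  `‖E(K,F)‖ ≤ O(1)(‖K‖ + ‖f‖)` — TEMPLATES only, no gauge theory); `LinearizationNear A T₀ a γ`: `‖fderiv ℂ (A g) 0 − T₀‖ ≤ a·g` (the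
  linearised step at the bare state is first-order close in the coupling to the ONE reference operator of (R43)); the intermediate `RemainderOsc`.
* §2 SCHWARZ (Mathlib `Complex.dist_le_div_mul_dist_of_mapsTo_ball`, maps between complex normed spaces): `linearDefect_of_remainderOsc` — a remainder
  `A g − T₀` complex-differentiable on `ball 0 ϱ` with oscillation `≤ m` is `2m∕(ϱ − R₀)`-Lipschitz on `closedBall 0 R₀` when `3R₀ < ϱ`:
  `LinearDefect A (T₀.restrictScalars ℝ) (closedBall 0 R₀) (2m∕(ϱ − R₀)) γ`.
* §3 SECOND ORDER: `norm_fderiv_le_of_stateAnalytic` (Cauchy: `‖fderiv ℂ (A g) 0‖ ≤ M₀∕ϱ₀`, Mathlib `Complex.norm_fderiv_le_div_of_mapsTo_ball`);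
  `taylor_two_of_stateAnalytic` (Schwarz with vanishing first order, Mathlib `Complex.dist_le_mul_div_pow_of_mapsTo_ball_of_isLittleO`, `n = 1`:
  `‖A g z − A g 0 − fderiv ℂ (A g) 0 z‖ ≤ 2M₀(‖z‖∕ϱ₀)²`); `remainderOsc_of_stateAnalytic`: oscillation `2M₀(ϱ∕ϱ₀)² + aγϱ` on `ball 0 ϱ`, `ϱ ≤ ϱ₀`.
* §4 THE DERIVED DEFECT AND THE FACES: `anDefect M₀ ϱ₀ a γ ϱ R₀ = 2(2M₀(ϱ∕ϱ₀)² + aγϱ)∕(ϱ − R₀)` (`anDefect_four`: `= (64∕3)M₀R₀∕ϱ₀² + (8∕3)aγ` at `ϱ = 4R₀` —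
  (R43) §4's shape `aγ + bρ` with `b` DERIVED from `M₀, ϱ₀`); `linearDefect_of_stateAnalytic`; `orbitStability_of_stateAnalytic`, `ne4_of_stateAnalytic` — (R43)'s
  conclusions (orbit stability; node U2's triple `ScaleShiftRate ∧ HistLipschitz ∧ FadingMemory` at rate `θ′ + Kc·anDefect`) from: ONE contracting power of
  `T₀.restrictScalars ℝ` [Gaussian; or a spectral-radius bound, census (R45)], an invariant set inside `closedBall 0 R₀` [or a small source, (R45)
  `invariant_gaugeBall` ∕ §5 here], state analyticity with a sup bound, the linearisation shape, coupling-Lipschitz, first step, read-out — NO modulus-type input.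
* §5 `invariant_closedBall_oneStep`: in the printed templates' one-step currency (`‖T₀‖ ≤ κ`, «κ = O(L⁻²)» for L large) the NORM ball is invariant under
  `(κ + δ)R₀ + s ≤ R₀`; at Bałaban's FIXED L the gauge-ball version of (R45) replaces it.
* §6 ORDER-SHARPNESS: for the quadratic scheme `quad c g z = c·z²` on `ℂ` (`stateAnalytic_quad`: sup bound `‖c‖ϱ₀²`; `linearizationNear_quad`) §4 gives the defect
  `(64∕3)‖c‖R₀` on `closedBall 0 R₀` (`anDefect_four`), and `le_defect_quad` shows NO defect below `‖c‖R₀` exists there: linear in the radius is the true order.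

WHAT THIS SAYS FOR THE ROW (census (R46); classification words UNCHANGED — DEPENDENT; U2 WORK done; upstream WORK-bound LARGE; 0∕9).  On (R42)'s idea road
the input list is now stated ENTIRELY in the currency of Bałaban's printed inductive method — analyticity on complex domains of ONE k-uniform norm with uniform
bounds — plus ONE spectral datum on the Gaussian linearisation: {`ρ(T₀) < 1` after extraction [Gaussian]; RT_g extends to a complex-analytic self-map of a ball
of radius `ϱ₀` in ONE k-uniform Banach norm on NODE O's (complexified) activities, bounded by `M₀` [printed TYPE for fields; NOT PRINTED for activities —
THIS is now the located missing statement, a Brydges–Dimock–Hurd ∕ Brydges–Slade-type «`K_+` analytic in `K`» theorem for the block-averaged non-abelian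
gauge step]; the
linearisation at the pure Wilson action `a·g`-close to `T₀`; the one-step source small against the gap; coupling- and read-out-Lipschitz constants} ⟹ NE4,
node U2's β-side list and (AF-0r) at every rate above `ρ(T₀)`.  The modulus wall (M) is thereby absorbed, on this road, into an analyticity-domain statement
— the same absorption the β-side census performed; nothing of Bałaban's is asserted and the statement for RT remains UNPRINTED.
-/

namespace Summit.QuantumFields.BalabanUV.T4Continuum.Spine.NE4

open Literature.MathematicalPhysics.QuantumFieldTheory.Balaban1983to89
open Literature.MathematicalPhysics.QuantumFieldTheory.Balaban1983to89.FlowStep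
open Literature.MathematicalPhysics.QuantumFieldTheory.Balaban1983to89.T4CouplingMatching
  (ScaleShiftRate HistLipschitz FadingMemory)
open Literature.MathematicalPhysics.QuantumFieldTheory.Balaban1983to89.T4SpectralRenewal (Kc Kc_nonneg)
open Metric Set

namespace Markov

/-! ## §1 Shapes: analyticity of the step in the state with a sup bound; the linearisation at the bare state close to ONE operator -/

section Shapes

variable {E : Type*} [NormedAddCommGroup E] [NormedSpace ℂ E]

/-- [shape] HYPOTHESIS SHAPE (NOT PRINTED for Bałaban's RT as a statement about the STATE; printed TYPE for the FIELD dependence, [Balaban1987RG1] p. 264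
«analytic … uniformly bounded»; printed for the state dependence of scalar-field steps, [BrydgesDimockHurd1998CJM] Thm 5 «E is jointly analytic in K, F»,
[BrydgesSlade2015RGV] Thm 1.8.2 «analytic in (V, K)» — TEMPLATES only):
**STATE ANALYTICITY WITH A SUP BOUND** — at every coupling `g ∈ ]0,γ]` the step `A g` is complex-differentiable on the open ball `ball 0 ϱ₀` of the state space
and `‖A g z − A g 0‖ ≤ M₀` there.  NOT a fact. [folklore] -/
def StateAnalytic (A : ℝ → E → E) (ϱ₀ M₀ γ : ℝ) : Prop :=
  ∀ g : ℝ, 0 < g → g ≤ γ → DifferentiableOn ℂ (A g) (ball (0 : E) ϱ₀) ∧ ∀ z ∈ ball (0 : E) ϱ₀, ‖A g z - A g 0‖ ≤ M₀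

/-- [shape] HYPOTHESIS SHAPE (UNPRINTED): **THE LINEARISATION AT THE BARE STATE IS `a·g`-CLOSE TO ONE OPERATOR** — `‖fderiv ℂ (A g) 0 − T₀‖ ≤ a·g` for
`g ∈ ]0,γ]` (`T₀` = the coupling-independent reference of (R43), for RT the Gaussian linearisation; the coupling dependence of the linearised step is
first order in `g`).  NOT a fact. [folklore] -/
def LinearizationNear (A : ℝ → E → E) (T₀ : E →L[ℂ] E) (a γ : ℝ) : Prop :=
  ∀ g : ℝ, 0 < g → g ≤ γ → ‖fderiv ℂ (A g) 0 - T₀‖ ≤ a * g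

/-- [shape] INTERMEDIATE SHAPE: **REMAINDER OSCILLATION** — the remainder `z ↦ A g z − T₀ z` is complex-differentiable on `ball 0 ϱ` and oscillates by at most
`m` there: `‖(A g z − T₀ z) − (A g 0 − T₀ 0)‖ ≤ m`.  Derived from the two shapes above in §3; consumed by §2. [folklore] -/
def RemainderOsc (A : ℝ → E → E) (T₀ : E →L[ℂ] E) (ϱ m γ : ℝ) : Prop :=
  ∀ g : ℝ, 0 < g → g ≤ γ → DifferentiableOn ℂ (fun z => A g z - T₀ z) (ball (0 : E) ϱ) ∧
    ∀ z ∈ ball (0 : E) ϱ, ‖(A g z - T₀ z) - (A g 0 - T₀ 0)‖ ≤ m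

/-- [bookkeeping] The defect shape is monotone in the set. [folklore] -/
theorem LinearDefect.mono {F : Type*} [NormedAddCommGroup F] [NormedSpace ℝ F] {A : ℝ → F → F} {T₀ : F →L[ℝ] F} {S S' : Set F}
    {δ γ : ℝ} (h : LinearDefect A T₀ S δ γ) (hS : S' ⊆ S) : LinearDefect A T₀ S' δ γ :=
  fun g hg0 hgγ x hx y hy => h g hg0 hgγ x (hS hx) y (hS hy)

end Shapes

/-! ## §2 Schwarz: a bounded oscillation of the analytic remainder on the ball of radius `ϱ` is a Lipschitz defect `2m∕(ϱ − R₀)` on the ball of radius `R₀ < ϱ∕3` -/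

section Schwarz

variable {E : Type*} [NormedAddCommGroup E] [NormedSpace ℂ E] {A : ℝ → E → E} {T₀ : E →L[ℂ] E}

/-- **THE DEFECT FROM A SUP BOUND, BY SCHWARZ's LEMMA** (Mathlib `Complex.dist_le_div_mul_dist_of_mapsTo_ball`, the Banach-space form): if the remainder
`A g − T₀` is complex-differentiable on `ball 0 ϱ` with oscillation `≤ m` there, then on `closedBall 0 R₀` with `3R₀ < ϱ` it is `2m∕(ϱ − R₀)`-Lipschitz:
`LinearDefect A (T₀.restrictScalars ℝ) (closedBall 0 R₀) (2m∕(ϱ − R₀)) γ`.  (Centre the Schwarz ball at `y`, radius `ϱ − R₀`; it maps into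
`closedBall (f y) 2m`; `x` lies in it since `‖x − y‖ ≤ 2R₀ < ϱ − R₀`.) [folklore] -/
theorem linearDefect_of_remainderOsc {ϱ m γ R₀ : ℝ} (hR : 0 ≤ R₀) (h3 : 3 * R₀ < ϱ) (h : RemainderOsc A T₀ ϱ m γ) :
    LinearDefect A (T₀.restrictScalars ℝ) (closedBall (0 : E) R₀) (2 * m / (ϱ - R₀)) γ := by
  intro g hg0 hgγ x hx y hy
  obtain ⟨hd, hosc⟩ := h g hg0 hgγ
  set f : E → E := fun z => A g z - T₀ z with hf
  rw [mem_closedBall_zero_iff] at hx hy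
  have hsub : ball y (ϱ - R₀) ⊆ ball (0 : E) ϱ := by
    intro z hz
    rw [mem_ball_zero_iff]
    rw [mem_ball, dist_eq_norm] at hz
    calc ‖z‖ = ‖(z - y) + y‖ := by rw [sub_add_cancel]
      _ ≤ ‖z - y‖ + ‖y‖ := norm_add_le _ _
      _ < (ϱ - R₀) + R₀ := add_lt_add_of_lt_of_le hz hy
      _ = ϱ := by ring
  have hy0 : y ∈ ball (0 : E) ϱ := mem_ball_zero_iff.mpr (by linarith)
  have hmaps : MapsTo f (ball y (ϱ - R₀)) (closedBall (f y) (2 * m)) := by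
    intro z hz
    rw [mem_closedBall, dist_eq_norm]
    have e : f z - f y = (f z - f 0) - (f y - f 0) := by abel
    calc ‖f z - f y‖ = ‖(f z - f 0) - (f y - f 0)‖ := by rw [e]
      _ ≤ ‖f z - f 0‖ + ‖f y - f 0‖ := norm_sub_le _ _
      _ ≤ m + m := add_le_add (hosc z (hsub hz)) (hosc y hy0)
      _ = 2 * m := by ring
  have hx' : x ∈ ball y (ϱ - R₀) := by
    rw [mem_ball, dist_eq_norm]
    calc ‖x - y‖ ≤ ‖x‖ + ‖y‖ := norm_sub_le _ _
      _ ≤ R₀ + R₀ := add_le_add hx hy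
      _ < ϱ - R₀ := by linarith
  have key := Complex.dist_le_div_mul_dist_of_mapsTo_ball (hd.mono hsub) hmaps hx'
  rw [dist_eq_norm, dist_eq_norm] at key
  have e : (A g x - A g y) - (T₀.restrictScalars ℝ) (x - y) = f x - f y := by
    simp only [hf, ContinuousLinearMap.coe_restrictScalars', map_sub]; abel
  rw [e]; exact key

end Schwarz

/-! ## §3 Second order: the oscillation is `2M₀(ϱ∕ϱ₀)² + aγϱ` on the ball of radius `ϱ ≤ ϱ₀` (Schwarz with vanishing first order + Cauchy for the derivative) -/

section SecondOrder

variable {E : Type*} [NormedAddCommGroup E] [NormedSpace ℂ E] {A : ℝ → E → E} {T₀ : E →L[ℂ] E}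

/-- **CAUCHY's ESTIMATE FOR THE LINEARISATION** (Mathlib `Complex.norm_fderiv_le_div_of_mapsTo_ball`): under `StateAnalytic A ϱ₀ M₀ γ`,
`‖fderiv ℂ (A g) 0‖ ≤ M₀ ∕ ϱ₀`. [folklore] -/
theorem norm_fderiv_le_of_stateAnalytic {ϱ₀ M₀ γ : ℝ} (hϱ : 0 < ϱ₀) (h : StateAnalytic A ϱ₀ M₀ γ) {g : ℝ} (hg0 : 0 < g) (hgγ : g ≤ γ) :
    ‖fderiv ℂ (A g) 0‖ ≤ M₀ / ϱ₀ :=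
  Complex.norm_fderiv_le_div_of_mapsTo_ball (h g hg0 hgγ).1
    (fun z hz => mem_closedBall.mpr (by rw [dist_eq_norm]; exact (h g hg0 hgγ).2 z hz)) hϱ

/-- **THE SECOND-ORDER TAYLOR REMAINDER FROM ANALYTICITY AND A SUP BOUND** (Mathlib's Schwarz lemma with vanishing first order,
`Complex.dist_le_mul_div_pow_of_mapsTo_ball_of_isLittleO`, `n = 1`): under `StateAnalytic A ϱ₀ M₀ γ`, for `z ∈ ball 0 ϱ₀`,
`‖A g z − A g 0 − fderiv ℂ (A g) 0 z‖ ≤ 2M₀·(‖z‖∕ϱ₀)²`. [folklore] -/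
theorem taylor_two_of_stateAnalytic {ϱ₀ M₀ γ : ℝ} (hϱ : 0 < ϱ₀) (h : StateAnalytic A ϱ₀ M₀ γ) {g : ℝ} (hg0 : 0 < g) (hgγ : g ≤ γ)
    {z : E} (hz : z ∈ ball (0 : E) ϱ₀) :
    ‖A g z - A g 0 - fderiv ℂ (A g) 0 z‖ ≤ 2 * M₀ * (‖z‖ / ϱ₀) ^ 2 := by
  obtain ⟨hdA, hbd⟩ := h g hg0 hgγ
  have hM : 0 ≤ M₀ := le_trans (norm_nonneg _) (hbd 0 (mem_ball_self hϱ))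
  set T := fderiv ℂ (A g) 0 with hT
  have hTn : ‖T‖ ≤ M₀ / ϱ₀ := norm_fderiv_le_of_stateAnalytic hϱ h hg0 hgγ
  set N : E → E := fun w => A g w - A g 0 - T w with hN
  have hN0 : N 0 = 0 := by simp [hN]
  have hdN : DifferentiableOn ℂ N (ball (0 : E) ϱ₀) :=
    (hdA.sub_const (A g 0)).sub (T.differentiable.differentiableOn)
  have hmaps : MapsTo N (ball (0 : E) ϱ₀) (closedBall (N 0) (2 * M₀)) := by
    intro w hw
    rw [hN0, mem_closedBall_zero_iff]
    have hw' : ‖w‖ ≤ ϱ₀ := (mem_ball_zero_iff.mp hw).le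
    calc ‖A g w - A g 0 - T w‖ ≤ ‖A g w - A g 0‖ + ‖T w‖ := norm_sub_le _ _
      _ ≤ M₀ + ‖T‖ * ‖w‖ := add_le_add (hbd w hw) (T.le_opNorm w)
      _ ≤ M₀ + M₀ / ϱ₀ * ϱ₀ := by gcongr
      _ = 2 * M₀ := by field_simp; ring
  have hderiv : HasFDerivAt (A g) T 0 := (hdA.differentiableAt (ball_mem_nhds (0 : E) hϱ)).hasFDerivAt
  have hlo' : (fun w => N w - N 0) =o[nhds (0 : E)] (fun w => w - 0) :=
    hderiv.isLittleO.congr_left fun w => by simp [hN]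
  have hlo : (fun w => N w - N 0) =o[nhds (0 : E)] (fun w => ‖w - 0‖ ^ 1) :=
    (Asymptotics.isLittleO_norm_right.mpr hlo').congr_right fun w => (pow_one ‖w - 0‖).symm
  have key := Complex.dist_le_mul_div_pow_of_mapsTo_ball_of_isLittleO (n := 1) hdN hmaps hlo hz
  rw [hN0, dist_zero_right, dist_zero_right] at key
  simpa [hN] using key

/-- **THE REMAINDER OSCILLATION FROM STATE ANALYTICITY** (§3's two estimates + the linearisation shape): `StateAnalytic A ϱ₀ M₀ γ`, `LinearizationNear A T₀ a γ`,
`0 < ϱ ≤ ϱ₀`, `0 ≤ a` ⟹ `RemainderOsc A T₀ ϱ (2M₀(ϱ∕ϱ₀)² + aγϱ) γ`. [folklore] -/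
theorem remainderOsc_of_stateAnalytic {ϱ₀ M₀ γ a ϱ : ℝ} (hϱ₀ : 0 < ϱ₀) (hϱ : 0 < ϱ) (hϱle : ϱ ≤ ϱ₀) (ha : 0 ≤ a)
    (h : StateAnalytic A ϱ₀ M₀ γ) (hlin : LinearizationNear A T₀ a γ) :
    RemainderOsc A T₀ ϱ (2 * M₀ * (ϱ / ϱ₀) ^ 2 + a * γ * ϱ) γ := by
  intro g hg0 hgγ
  obtain ⟨hdA, hbd⟩ := h g hg0 hgγ
  have hM : 0 ≤ M₀ := le_trans (norm_nonneg _) (hbd 0 (mem_ball_self hϱ₀))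
  have hsub : ball (0 : E) ϱ ⊆ ball (0 : E) ϱ₀ := ball_subset_ball hϱle
  refine ⟨(hdA.mono hsub).sub T₀.differentiable.differentiableOn, fun z hz => ?_⟩
  have hz' : ‖z‖ < ϱ := mem_ball_zero_iff.mp hz
  set T := fderiv ℂ (A g) 0 with hT
  have h2 := taylor_two_of_stateAnalytic hϱ₀ h hg0 hgγ (hsub hz)
  have hlin' : ‖T - T₀‖ ≤ a * g := hlin g hg0 hgγ
  have e : (A g z - T₀ z) - (A g 0 - T₀ 0) = (A g z - A g 0 - T z) + (T - T₀) z := by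
    simp only [map_zero, sub_zero, sub_apply]; abel
  rw [e]
  calc ‖(A g z - A g 0 - T z) + (T - T₀) z‖ ≤ ‖A g z - A g 0 - T z‖ + ‖(T - T₀) z‖ := norm_add_le _ _
    _ ≤ 2 * M₀ * (‖z‖ / ϱ₀) ^ 2 + ‖T - T₀‖ * ‖z‖ := add_le_add h2 ((T - T₀).le_opNorm z)
    _ ≤ 2 * M₀ * (ϱ / ϱ₀) ^ 2 + (a * g) * ϱ := by
        have h1 : (‖z‖ / ϱ₀) ^ 2 ≤ (ϱ / ϱ₀) ^ 2 := by gcongr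
        exact add_le_add (mul_le_mul_of_nonneg_left h1 (by positivity))
          (mul_le_mul hlin' hz'.le (norm_nonneg _) (by positivity))
    _ ≤ 2 * M₀ * (ϱ / ϱ₀) ^ 2 + a * γ * ϱ := by
        have : a * g * ϱ ≤ a * γ * ϱ := by gcongr
        linarith

end SecondOrder

/-! ## §4 The analytic defect and the faces: (R43) with (N) DERIVED from state analyticity + a sup bound + the linearisation shape -/

section Faces

variable {E : Type*} [NormedAddCommGroup E] [NormedSpace ℂ E] {A : ℝ → E → E} {T₀ : E →L[ℂ] E} {S : Set E} {ξ : E}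
  {r : E → ℝ} {β : HBeta} {ϱ₀ M₀ a γ ϱ R₀ θ' ℓ D cr : ℝ} {N : ℕ}

/-- THE ANALYTIC DEFECT: `anDefect M₀ ϱ₀ a γ ϱ R₀ = 2·(2M₀(ϱ∕ϱ₀)² + aγϱ)∕(ϱ − R₀)` — second order in the radius `ϱ` of the working ball and first order in the
coupling box `γ`; e.g. `ϱ = 4R₀ ≤ ϱ₀` gives `(64∕3)·M₀R₀∕ϱ₀² + (8∕3)·aγ`, the shape `aγ + bρ` of (R43) §4 with `b` DERIVED. [folklore] -/
noncomputable def anDefect (M₀ ϱ₀ a γ ϱ R₀ : ℝ) : ℝ := 2 * (2 * M₀ * (ϱ / ϱ₀) ^ 2 + a * γ * ϱ) / (ϱ - R₀)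

/-- [bookkeeping] the analytic defect is non-negative (`M₀, a, γ ≥ 0`, `R₀ < ϱ`). [folklore] -/
theorem anDefect_nonneg (hM : 0 ≤ M₀) (ha : 0 ≤ a) (hγ : 0 ≤ γ) (hϱ : 0 ≤ ϱ) (hR : R₀ < ϱ) : 0 ≤ anDefect M₀ ϱ₀ a γ ϱ R₀ := by
  unfold anDefect
  exact div_nonneg (by positivity) (by linarith)

/-- [bookkeeping] at `ϱ = 4R₀` the analytic defect is `(64∕3)·M₀·R₀∕ϱ₀² + (8∕3)·a·γ`. [folklore] -/
theorem anDefect_four (hR : 0 < R₀) (hϱ₀ : 0 < ϱ₀) :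
    anDefect M₀ ϱ₀ a γ (4 * R₀) R₀ = 64 / 3 * M₀ * R₀ / ϱ₀ ^ 2 + 8 / 3 * a * γ := by
  unfold anDefect
  field_simp
  ring

/-- **THE LINEARIZATION DEFECT (N) DERIVED** (§3 ∘ §2): `StateAnalytic A ϱ₀ M₀ γ`, `LinearizationNear A T₀ a γ`, `0 ≤ R₀`, `3R₀ < ϱ ≤ ϱ₀`, `0 ≤ a` ⟹
`LinearDefect A (T₀.restrictScalars ℝ) (closedBall 0 R₀) (anDefect M₀ ϱ₀ a γ ϱ R₀) γ`.  A modulus-type hypothesis (wall (M) of the cell in its local form) is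
traded for analyticity on a complex ball of ONE norm with a sup bound — the trade census (R34)∕(R37)∕(R40) made on the β-side, now on the state side.
HYPOTHESES ONLY; nothing of Bałaban's is asserted. [folklore] -/
theorem linearDefect_of_stateAnalytic (hϱ₀ : 0 < ϱ₀) (hR : 0 ≤ R₀) (h3 : 3 * R₀ < ϱ) (hϱle : ϱ ≤ ϱ₀) (ha : 0 ≤ a)
    (h : StateAnalytic A ϱ₀ M₀ γ) (hlin : LinearizationNear A T₀ a γ) :
    LinearDefect A (T₀.restrictScalars ℝ) (closedBall (0 : E) R₀) (anDefect M₀ ϱ₀ a γ ϱ R₀) γ :=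
  linearDefect_of_remainderOsc hR h3 (remainderOsc_of_stateAnalytic hϱ₀ (by linarith) hϱle ha h hlin)

/-- **ORBIT STABILITY FROM ANALYTIC DATA** ((R43)'s `orbitStability_of_linearDefect` with the derived defect): one contracting power
`‖(T₀.restrictScalars ℝ) ^ N‖ ≤ θ′ ^ N` of the real restriction (supplied e.g. by a spectral-radius bound, census (R45)), an invariant set `S ⊆ closedBall 0 R₀`,
state analyticity with a sup bound on `ball 0 ϱ₀`, the linearisation shape, `3R₀ < ϱ ≤ ϱ₀` ⟹ `OrbitStability A S Kc (θ′ + Kc·anDefect) γ`. [folklore] -/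
theorem orbitStability_of_stateAnalytic (hθ : 0 < θ') (hN : 1 ≤ N) (hT : ‖(T₀.restrictScalars ℝ) ^ N‖ ≤ θ' ^ N)
    (hInv : Invariant A S γ) (hS : S ⊆ closedBall (0 : E) R₀) (hϱ₀ : 0 < ϱ₀) (hR : 0 ≤ R₀) (h3 : 3 * R₀ < ϱ) (hϱle : ϱ ≤ ϱ₀)
    (ha : 0 ≤ a) (hγ : 0 ≤ γ) (hM : 0 ≤ M₀) (h : StateAnalytic A ϱ₀ M₀ γ) (hlin : LinearizationNear A T₀ a γ) :
    OrbitStability A S (Kc (T₀.restrictScalars ℝ) θ' N)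
      (θ' + Kc (T₀.restrictScalars ℝ) θ' N * anDefect M₀ ϱ₀ a γ ϱ R₀) γ :=
  orbitStability_of_linearDefect hθ hN hT hInv ((linearDefect_of_stateAnalytic hϱ₀ hR h3 hϱle ha h hlin).mono hS)
    (anDefect_nonneg hM ha hγ (by linarith) (by linarith))

/-- **NE4 ∕ NODE U2's β-SIDE TRIPLE FROM ANALYTIC DATA** ((R43)'s `ne4_of_linearDefect` with the DERIVED defect): with `ρ = θ′ + Kc·anDefect M₀ ϱ₀ a γ ϱ R₀`,
`ScaleShiftRate (cr·Kc·D·ρ) ρ γ β ∧ HistLipschitz Λ γ β ∧ FadingMemory (cr·Kc·ℓ) ρ Λ`, `Λ k i = cr·Kc·ℓ·ρ^{k−i}`.  Input list: one contracting power of the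
linearisation [for RT: Gaussian; or a spectral-radius bound, census (R45)], an invariant set inside the small ball [or a small source, (R45)], STATE ANALYTICITY with a sup
bound on a complex ball of ONE norm [printed TYPE for fields, TEMPLATE for the state], the linearisation `a·g`-close to `T₀` at the bare state, coupling-Lipschitz `ℓ`,
first step `D`, read-out `cr` — NO modulus-type hypothesis.  HYPOTHESES ONLY about an abstract scheme; NE4 for Bałaban's β is NOT proved. [folklore] -/
theorem ne4_of_stateAnalytic (hθ : 0 < θ') (hN : 1 ≤ N) (hT : ‖(T₀.restrictScalars ℝ) ^ N‖ ≤ θ' ^ N)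
    (hInv : Invariant A S γ) (hS : S ⊆ closedBall (0 : E) R₀) (hξ : ξ ∈ S) (hϱ₀ : 0 < ϱ₀) (hR : 0 ≤ R₀) (h3 : 3 * R₀ < ϱ)
    (hϱle : ϱ ≤ ϱ₀) (ha : 0 ≤ a) (hγ : 0 ≤ γ) (hM : 0 ≤ M₀) (h : StateAnalytic A ϱ₀ M₀ γ) (hlin : LinearizationNear A T₀ a γ)
    (hlip : StateCouplingLipschitz A S ℓ γ) (hfirst : FirstStep A ξ D γ) (hcr : 0 ≤ cr) (hℓ : 0 ≤ ℓ)
    (hrep : RepresentsAut A r ξ γ β) (hr : ReadLipschitzOn r S cr) :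
    ScaleShiftRate (cr * Kc (T₀.restrictScalars ℝ) θ' N * D *
        (θ' + Kc (T₀.restrictScalars ℝ) θ' N * anDefect M₀ ϱ₀ a γ ϱ R₀))
      (θ' + Kc (T₀.restrictScalars ℝ) θ' N * anDefect M₀ ϱ₀ a γ ϱ R₀) γ β ∧
    HistLipschitz (fun k i => cr * Kc (T₀.restrictScalars ℝ) θ' N * ℓ *
        (θ' + Kc (T₀.restrictScalars ℝ) θ' N * anDefect M₀ ϱ₀ a γ ϱ R₀) ^ (k - i)) γ β ∧
    FadingMemory (cr * Kc (T₀.restrictScalars ℝ) θ' N * ℓ) (θ' + Kc (T₀.restrictScalars ℝ) θ' N * anDefect M₀ ϱ₀ a γ ϱ R₀)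
      (fun k i => cr * Kc (T₀.restrictScalars ℝ) θ' N * ℓ *
        (θ' + Kc (T₀.restrictScalars ℝ) θ' N * anDefect M₀ ϱ₀ a γ ϱ R₀) ^ (k - i)) :=
  ne4_of_linearDefect hθ hN hT hInv hξ ((linearDefect_of_stateAnalytic hϱ₀ hR h3 hϱle ha h hlin).mono hS)
    (anDefect_nonneg hM ha hγ (by linarith) (by linarith)) hlip hfirst hcr hℓ hrep hr

end Faces

/-! ## §5 The one-step currency of the printed templates: with `‖T₀‖ + δ < 1` the NORM ball itself is invariant (no gauge needed) -/

section OneStep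

variable {F : Type*} [NormedAddCommGroup F] [NormedSpace ℝ F] {A : ℝ → F → F} {T₀ : F →L[ℝ] F} {κ δ s γ R₀ : ℝ}

/-- **INVARIANT NORM BALL IN THE ONE-STEP CURRENCY** (the printed templates' regime «κ = O(L⁻²) < 1», [BauerschmidtBrydgesSlade2019RG] Thm 2.3.1 — TEMPLATE):
`‖T₀‖ ≤ κ`, `LinearDefect A T₀ (closedBall 0 R₀) δ γ`, the source bound `FirstStep A 0 s γ` (`‖A g 0‖ ≤ s`) and the balance `(κ + δ)·R₀ + s ≤ R₀` ⟹
`Invariant A (closedBall 0 R₀) γ`.  At a FIXED block size the power ∕ gauge currency of census (R45) (`invariant_gaugeBall`) replaces this. [folklore] -/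
theorem invariant_closedBall_oneStep (hκ : ‖T₀‖ ≤ κ) (hdef : LinearDefect A T₀ (closedBall (0 : F) R₀) δ γ) (hδ0 : 0 ≤ δ)
    (hsrc : FirstStep A 0 s γ) (hR : 0 ≤ R₀) (hbal : (κ + δ) * R₀ + s ≤ R₀) : Invariant A (closedBall (0 : F) R₀) γ := by
  intro g hg0 hgγ x hx
  have h0 : (0 : F) ∈ closedBall (0 : F) R₀ := mem_closedBall_self hR
  have hx' : ‖x‖ ≤ R₀ := mem_closedBall_zero_iff.mp hx
  have hs : ‖A g 0‖ ≤ s := by simpa [dist_zero_right] using hsrc g hg0 hgγ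
  have hd := hdef g hg0 hgγ x hx 0 h0
  rw [sub_zero] at hd
  have hκ0 : 0 ≤ κ := (norm_nonneg _).trans hκ
  rw [mem_closedBall_zero_iff]
  have e : A g x = ((A g x - A g 0) - T₀ x) + T₀ x + A g 0 := by abel
  calc ‖A g x‖ = ‖((A g x - A g 0) - T₀ x) + T₀ x + A g 0‖ := by rw [← e]
    _ ≤ ‖(A g x - A g 0) - T₀ x‖ + ‖T₀ x‖ + ‖A g 0‖ := norm_add₃_le
    _ ≤ δ * ‖x‖ + ‖T₀‖ * ‖x‖ + s := add_le_add (add_le_add hd (T₀.le_opNorm x)) hs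
    _ ≤ δ * R₀ + κ * R₀ + s := by
        have h1 : δ * ‖x‖ ≤ δ * R₀ := mul_le_mul_of_nonneg_left hx' hδ0
        have h2 : ‖T₀‖ * ‖x‖ ≤ κ * R₀ := mul_le_mul hκ hx' (norm_nonneg _) hκ0
        linarith
    _ ≤ R₀ := by linarith

end OneStep

/-! ## §6 Order-sharpness: for the quadratic scheme `z ↦ c·z²` the derived defect is linear in `R₀`, and so is the best one -/

section Sharp

/-- The scalar QUADRATIC scheme `quad c g z = c·z²` on `ℂ` (coupling-independent; linearisation `0` at the bare state `0`). [folklore] -/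
def quad (c : ℂ) : ℝ → ℂ → ℂ := fun _ z => c * z ^ 2

/-- [witness] the quadratic scheme is state-analytic on every ball, with sup bound `‖c‖·ϱ₀²`. [folklore] -/
theorem stateAnalytic_quad (c : ℂ) (ϱ₀ γ : ℝ) : StateAnalytic (quad c) ϱ₀ (‖c‖ * ϱ₀ ^ 2) γ := by
  intro g _ _
  refine ⟨(differentiable_const c).mul (differentiable_pow 2) |>.differentiableOn, fun z hz => ?_⟩
  have hz' : ‖z‖ ≤ ϱ₀ := (mem_ball_zero_iff.mp hz).le
  simp only [quad]
  rw [zero_pow two_ne_zero, mul_zero, sub_zero, norm_mul, norm_pow]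
  exact mul_le_mul_of_nonneg_left (pow_le_pow_left₀ (norm_nonneg _) hz' 2) (norm_nonneg _)

/-- [witness] its linearisation at the bare state is `0` at every coupling: `LinearizationNear (quad c) 0 0 γ`. [folklore] -/
theorem linearizationNear_quad (c : ℂ) (γ : ℝ) : LinearizationNear (quad c) 0 0 γ := by
  intro g _ _
  have hd : HasFDerivAt (quad c g) (0 : ℂ →L[ℂ] ℂ) (0 : ℂ) := by
    rw [hasFDerivAt_iff_isLittleO_nhds_zero]
    have h2 : (fun h : ℂ => c * h ^ 2) =o[nhds (0 : ℂ)] (fun h => h) := by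
      have h3 := (Asymptotics.isLittleO_pow_pow (show 1 < 2 by norm_num) : (fun x : ℂ => x ^ 2) =o[nhds 0] fun x => x ^ 1)
      simpa using h3.const_mul_left c
    exact h2.congr_left fun h => by simp [quad]
  rw [hd.fderiv, sub_zero, norm_zero, zero_mul]

/-- **LOWER BOUND**: ANY defect of the quadratic scheme relative to `0` on `closedBall 0 R₀` (`R₀ > 0`, `γ > 0`) is at least `‖c‖·R₀` (test the pair `x = R₀`, `y = 0`).
With §4 (`anDefect_four`: `(64∕3)·(‖c‖ϱ₀²)·R₀∕ϱ₀² = (64∕3)‖c‖R₀`) the derived defect is within the absolute factor `64∕3` of the best one: the LINEAR dependence on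
the radius of the working ball is the true order. [folklore] -/
theorem le_defect_quad {c : ℂ} {R₀ δ γ : ℝ} (hR : 0 < R₀) (hγ : 0 < γ)
    (h : LinearDefect (quad c) ((0 : ℂ →L[ℂ] ℂ).restrictScalars ℝ) (closedBall (0 : ℂ) R₀) δ γ) : ‖c‖ * R₀ ≤ δ := by
  have hx : ((R₀ : ℝ) : ℂ) ∈ closedBall (0 : ℂ) R₀ := by
    rw [mem_closedBall_zero_iff, Complex.norm_real, Real.norm_eq_abs, abs_of_pos hR]
  have h0 : (0 : ℂ) ∈ closedBall (0 : ℂ) R₀ := mem_closedBall_self hR.le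
  have := h γ hγ le_rfl _ hx 0 h0
  simp only [quad, ContinuousLinearMap.coe_restrictScalars', sub_zero, zero_pow two_ne_zero,
    mul_zero, Complex.norm_real, Real.norm_eq_abs, abs_of_pos hR] at this
  -- this : ‖c‖ * R₀ ^ 2 ≤ δ * R₀  (the zero map applied is `0`)
  have this' : ‖c‖ * R₀ ^ 2 ≤ δ * R₀ := by simpa using this
  nlinarith

end Sharp

end Markov

end Summit.QuantumFields.BalabanUV.T4Continuum.Spine.NE4
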